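import Mathlib.GroupTheory.PresentedGroup
import Mathlib.GroupTheory.SemidirectProduct
import Mathlib.GroupTheory.OrderOfElement
import Mathlib.GroupTheory.Index
import Mathlib.Data.ZMod.Basic
import Mathlib.Algebra.BigOperators.Fin
import Mathlib.Tactic.Ring
import Mathlib.Algebra.Group.TypeTags.Finite
import Mathlib.Algebra.BigOperators.Group.List.Basic
import Literature.GroupTheory.CombinatorialGroupTheory.PuncturedSurfaceGroup
import HarnessLib

/-!
# Finite quotients of `Γ_{g,r}` with prescribed uniform cusp order

For a hyperbolic type `(g, r)` (`2g − 2 + r > 0`) and every `n ≥ 1`, the punctured surface group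
`Γ_{g,r} = ⟨a₁, b₁, …, a_g, b_g, c₁, …, c_r ∣ [a₁,b₁]⋯[a_g,b_g]·c₁⋯c_r⟩` has a normal subgroup `N` of
index dividing `n ^ 3` meeting EVERY cusp inertia group `⟨c_j⟩` in exactly `⟨c_j ^ n⟩`
(`exists_normal_inf_cuspInertia_eq`); equivalently a homomorphism to a finite group of order
dividing `n ^ 3` under which every `c_j` has order exactly `n`:
* `r` even: `Γ → ℤ/n`, `c_j ↦ (−1)^j`, `aᵢ, bᵢ ↦ 0`;
* `r ≥ 3` odd: `Γ → (ℤ/n)²`, `c₀ ↦ (1,0)`, `c₁ ↦ (0,1)`, `c₂ ↦ (−1,−1)`, then `c_j ↦ ±(1,0)`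
  alternately;
* `r = 1` (so `g ≥ 1`): `Γ → H_n = (ℤ/n)² ⋊ ℤ/n` (Heisenberg group mod `n`), `a₁ ↦ x`, `b₁ ↦ y`,
  `c₁ ↦ [x,y]⁻¹`, the commutator `[x,y]` being central of order `n`.
This is the group-theoretic core of "one verifies immediately … from the well-known structure of
fundamental groups of hyperbolic Riemann surfaces of finite type" in [SemiAnbd] Example 2.10
(coherence / total elevation of the semi-graph of anabelioids of a pointed stable curve need finite
quotients of the `Π_v` inducing the SAME quotient `ℤ/n` on the inertia group of a node from both of
its branches) [cite: MochizukiSemiAnbd2006, Ex. 2.10 p.31]; cell abc-iut, layer L3, row G31, seat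
abc-iut-L3-t4.  Theorems only.
-/

namespace Literature.GroupTheory.CombinatorialGroupTheory.PuncturedSurfaceGroup

open Multiplicative

variable {g r : ℕ}

/-! ### From prescribed cusp orders to the intersection with the cusp inertia groups -/

/-- The image of the relator of `Γ_{g,r}` under `FreeGroup.lift f` (copy of
`PuncturedSurfaceGroupCusps.lift_relator`, restated privately to keep this file's imports minimal).
[cite: MochizukiSemiAnbd2006, Ex. 2.10 p.31] -/
private theorem lift_relator' {M : Type*} [Group M] (f : puncturedSurfaceGen g r → M) :
    FreeGroup.lift f (relator g r) =
      ((List.finRange g).map fun i =>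
          f (Sum.inl (i, false)) * f (Sum.inl (i, true)) * (f (Sum.inl (i, false)))⁻¹ *
            (f (Sum.inl (i, true)))⁻¹).prod *
        ((List.finRange r).map fun j => f (Sum.inr j)).prod := by
  simp only [relator, map_mul, map_list_prod, List.map_map, Function.comp_def, map_inv, genA, genB,
    genC, FreeGroup.lift_apply_of]

/-- If `f(c_j)` has order `n`, then `Ker f ∩ ⟨c_j⟩ = ⟨c_j ^ n⟩`.
[cite: MochizukiSemiAnbd2006, Ex. 2.10 p.31] -/
theorem ker_inf_cuspInertia_eq {Q : Type*} [Group Q] (f : PuncturedSurfaceGroup g r →* Q) {n : ℕ}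
    (j : Fin r) (hj : orderOf (f (c j)) = n) :
    f.ker ⊓ cuspInertia j = Subgroup.zpowers (c j ^ n) := by
  ext x
  simp only [Subgroup.mem_inf, MonoidHom.mem_ker, cuspInertia, Subgroup.mem_zpowers_iff]
  constructor
  · rintro ⟨hx, k, rfl⟩
    rw [map_zpow] at hx
    have hdvd : (n : ℤ) ∣ k := by rw [← hj]; exact orderOf_dvd_iff_zpow_eq_one.2 hx
    obtain ⟨m, rfl⟩ := hdvd
    exact ⟨m, by rw [← zpow_natCast, ← zpow_mul]⟩
  · rintro ⟨m, rfl⟩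
    refine ⟨?_, m * n, ?_⟩
    · rw [map_zpow, map_pow, ← hj, pow_orderOf_eq_one, one_zpow]
    · rw [← zpow_natCast, ← zpow_mul, mul_comm]

/-- The index of `Ker f` divides the order of the target.
[cite: MochizukiSemiAnbd2006, Ex. 2.10 p.31] -/
theorem index_ker_dvd_card {Q : Type*} [Group Q] [Finite Q] (f : PuncturedSurfaceGroup g r →* Q) :
    f.ker.index ∣ Nat.card Q := by
  rw [Subgroup.index_ker]
  exact Subgroup.card_subgroup_dvd_card f.range

/-! ### The case `r` even: `Γ → ℤ/n` -/

/-- The alternating product `e, e⁻¹, e, e⁻¹, …` of even length is trivial. [folklore] -/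
private theorem prod_alternating_even {M : Type*} [CommGroup M] (e : M) (k : ℕ) :
    (∏ j : Fin (2 * k), (if j.val % 2 = 0 then e else e⁻¹)) = 1 := by
  induction k with
  | zero => simp
  | succ k ih =>
    rw [show 2 * (k + 1) = 2 * k + 1 + 1 from by omega, Fin.prod_univ_succ, Fin.prod_univ_succ]
    have h2 : (∏ j : Fin (2 * k), (if (j.succ.succ : Fin (2 * k + 1 + 1)).val % 2 = 0 then e else e⁻¹))
        = ∏ j : Fin (2 * k), (if j.val % 2 = 0 then e else e⁻¹) := by
      refine Finset.prod_congr rfl fun j _ => ?_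
      have hj : ((j.succ.succ : Fin (2 * k + 1 + 1)).val) % 2 = j.val % 2 := by
        simp only [Fin.val_succ]; omega
      simp only [hj]
    rw [h2, ih]
    simp

/-- For `r` even: a homomorphism `Γ_{g,r} → ℤ/n` (`c_j ↦ (−1)^j`, `aᵢ, bᵢ ↦ 0`) under
which every cusp generator has order exactly `n`. [cite: MochizukiSemiAnbd2006, Ex. 2.10 p.31] -/
theorem exists_hom_of_even {k : ℕ} (hr : r = 2 * k) (n : ℕ) :
    ∃ f : PuncturedSurfaceGroup g r →* Multiplicative (ZMod n), ∀ j, orderOf (f (c j)) = n := by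
  subst hr
  let e : Multiplicative (ZMod n) := ofAdd 1
  let F : puncturedSurfaceGen g (2 * k) → Multiplicative (ZMod n) :=
    Sum.elim (fun _ => 1) fun j => if j.val % 2 = 0 then e else e⁻¹
  have hrel : ∀ w ∈ ({relator g (2 * k)} : Set (FreeGroup (puncturedSurfaceGen g (2 * k)))),
      FreeGroup.lift F w = 1 := by
    intro w hw
    rw [Set.mem_singleton_iff] at hw
    rw [hw, lift_relator']
    have h1 : ((List.finRange g).map fun i =>
        F (Sum.inl (i, false)) * F (Sum.inl (i, true)) * (F (Sum.inl (i, false)))⁻¹ *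
          (F (Sum.inl (i, true)))⁻¹).prod = 1 :=
      List.prod_eq_one fun y hy => by
        obtain ⟨i, -, rfl⟩ := List.mem_map.mp hy
        simp [F]
    have h2 : ((List.finRange (2 * k)).map fun j => F (Sum.inr j)).prod = 1 := by
      rw [← Fin.prod_univ_def]
      exact prod_alternating_even e k
    rw [h1, h2, one_mul]
  refine ⟨PresentedGroup.toGroup hrel, fun j => ?_⟩
  rw [c, PresentedGroup.toGroup.of]
  change orderOf (if j.val % 2 = 0 then e else e⁻¹) = n
  have he : orderOf e = n := by
    rw [orderOf_ofAdd_eq_addOrderOf]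
    exact ZMod.addOrderOf_one n
  split_ifs
  · exact he
  · rw [orderOf_inv]; exact he

/-! ### The case `r ≥ 3` odd: `Γ → (ℤ/n)²` -/

/-- For `r = 2k + 3`: a homomorphism `Γ_{g,r} → (ℤ/n)²` (`c₀ ↦ (1,0)`, `c₁ ↦ (0,1)`, `c₂ ↦ (−1,−1)`,
then `±(1,0)` alternately; `aᵢ, bᵢ ↦ 0`) under which every cusp generator has order exactly `n`.
[cite: MochizukiSemiAnbd2006, Ex. 2.10 p.31] -/
theorem exists_hom_of_odd {k : ℕ} (hr : r = 2 * k + 3) (n : ℕ) :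
    ∃ f : PuncturedSurfaceGroup g r →* Multiplicative (ZMod n × ZMod n),
      ∀ j, orderOf (f (c j)) = n := by
  subst hr
  let e : Multiplicative (ZMod n × ZMod n) := ofAdd (1, 0)
  let u₁ : Multiplicative (ZMod n × ZMod n) := ofAdd (0, 1)
  let u₂ : Multiplicative (ZMod n × ZMod n) := ofAdd (-1, -1)
  let G : ℕ → Multiplicative (ZMod n × ZMod n) := fun m =>
    if m = 0 then e else if m = 1 then u₁ else if m = 2 then u₂ else if m % 2 = 1 then e else e⁻¹
  let F : puncturedSurfaceGen g (2 * k + 3) → Multiplicative (ZMod n × ZMod n) :=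
    Sum.elim (fun _ => 1) fun j => G j.val
  have he : orderOf e = n := by
    rw [orderOf_ofAdd_eq_addOrderOf, Prod.addOrderOf, ZMod.addOrderOf_one, addOrderOf_zero,
      Nat.lcm_one_right]
  have hG : ∀ m, orderOf (G m) = n := by
    intro m
    simp only [G]
    split_ifs
    · exact he
    · rw [orderOf_ofAdd_eq_addOrderOf, Prod.addOrderOf, ZMod.addOrderOf_one, addOrderOf_zero,
        Nat.lcm_one_left]
    · rw [orderOf_ofAdd_eq_addOrderOf, Prod.addOrderOf, addOrderOf_neg, ZMod.addOrderOf_one,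
        Nat.lcm_self]
    · exact he
    · rw [orderOf_inv]; exact he
  have hrel : ∀ w ∈ ({relator g (2 * k + 3)} : Set (FreeGroup (puncturedSurfaceGen g (2 * k + 3)))),
      FreeGroup.lift F w = 1 := by
    intro w hw
    rw [Set.mem_singleton_iff] at hw
    rw [hw, lift_relator']
    have h1 : ((List.finRange g).map fun i =>
        F (Sum.inl (i, false)) * F (Sum.inl (i, true)) * (F (Sum.inl (i, false)))⁻¹ *
          (F (Sum.inl (i, true)))⁻¹).prod = 1 :=
      List.prod_eq_one fun y hy => by
        obtain ⟨i, -, rfl⟩ := List.mem_map.mp hy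
        simp [F]
    have htail : (∏ j : Fin (2 * k), G (j.succ.succ.succ : Fin (2 * k + 1 + 1 + 1)).val) = 1 := by
      have hcongr : (∏ j : Fin (2 * k), G (j.succ.succ.succ : Fin (2 * k + 1 + 1 + 1)).val) =
          ∏ j : Fin (2 * k), (if j.val % 2 = 0 then e else e⁻¹) := by
        refine Finset.prod_congr rfl fun j _ => ?_
        simp only [G, Fin.val_succ]
        rw [if_neg (by omega), if_neg (by omega), if_neg (by omega)]
        by_cases hj : j.val % 2 = 0
        · rw [if_pos (by omega), if_pos hj]
        · rw [if_neg (by omega), if_neg hj]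
      rw [hcongr]
      exact prod_alternating_even e k
    have h2 : ((List.finRange (2 * k + 3)).map fun j => F (Sum.inr j)).prod = 1 := by
      rw [← Fin.prod_univ_def]
      change (∏ j : Fin (2 * k + 1 + 1 + 1), G j.val) = 1
      rw [Fin.prod_univ_succ, Fin.prod_univ_succ, Fin.prod_univ_succ, htail, mul_one]
      have hG0 : G 0 = e := by simp [G]
      have hG1 : G 1 = u₁ := by simp [G]
      have hG2 : G 2 = u₂ := by simp [G]
      change G 0 * (G 1 * G 2) = 1
      rw [hG0, hG1, hG2]
      change ofAdd ((1 : ZMod n), (0 : ZMod n)) * (ofAdd ((0 : ZMod n), (1 : ZMod n)) *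
        ofAdd ((-1 : ZMod n), (-1 : ZMod n))) = 1
      rw [← ofAdd_add, ← ofAdd_add, Prod.mk_add_mk, Prod.mk_add_mk]
      simp
    rw [h1, h2, one_mul]
  refine ⟨PresentedGroup.toGroup hrel, fun j => ?_⟩
  rw [c, PresentedGroup.toGroup.of]
  exact hG j.val

/-! ### The case `r = 1`: the Heisenberg group mod `n` -/

/-- For `r = 1` and `g ≥ 1`: a homomorphism `Γ_{g,1} → H_n = (ℤ/n × ℤ/n) ⋊ ℤ/n` (the Heisenberg
group mod `n`, the factor `ℤ/n` acting by shears), `a₁ ↦ x = (0; 1)`, `b₁ ↦ y = ((1,0); 0)`, other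
`aᵢ, bᵢ ↦ 1`, `c₁ ↦ [x,y]⁻¹` where `[x,y] = ((0,1); 0)` is central of order `n`; so `c₁` has order
exactly `n` and the target has order `n ^ 3`. [cite: MochizukiSemiAnbd2006, Ex. 2.10 p.31] -/
theorem exists_hom_of_one (hg : 0 < g) (n : ℕ) :
    ∃ (σ : Multiplicative (ZMod n) →* MulAut (Multiplicative (ZMod n × ZMod n)))
      (f : PuncturedSurfaceGroup g 1 →*
        (Multiplicative (ZMod n × ZMod n) ⋊[σ] Multiplicative (ZMod n))),
      ∀ j, orderOf (f (c j)) = n := by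
  obtain ⟨g', rfl⟩ : ∃ g', g = g' + 1 := ⟨g - 1, by omega⟩
  let σ : Multiplicative (ZMod n) →* MulAut (Multiplicative (ZMod n × ZMod n)) :=
    { toFun := fun t =>
        { toFun := fun q => ofAdd (q.toAdd.1, q.toAdd.2 + t.toAdd * q.toAdd.1)
          invFun := fun q => ofAdd (q.toAdd.1, q.toAdd.2 - t.toAdd * q.toAdd.1)
          left_inv := fun q => by simp
          right_inv := fun q => by simp
          map_mul' := fun q q' => by
            rw [← ofAdd_add, Prod.mk_add_mk, toAdd_mul, Prod.fst_add, Prod.snd_add]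
            exact congrArg ofAdd (Prod.ext rfl (by dsimp only; ring)) }
      map_one' := by
        ext q
        · simp
        · simp
      map_mul' := fun t t' => by
        ext q
        · simp
        · simp only [toAdd_mul, MulAut.mul_apply, MulEquiv.coe_mk, Equiv.coe_fn_mk, toAdd_ofAdd]
          ring }
  have hσ : ∀ (t : Multiplicative (ZMod n)) (a b : ZMod n),
      σ t (ofAdd (a, b)) = ofAdd (a, b + t.toAdd * a) := fun _ _ _ => rfl
  let x : Multiplicative (ZMod n × ZMod n) ⋊[σ] Multiplicative (ZMod n) :=
    SemidirectProduct.inr (ofAdd 1)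
  let y : Multiplicative (ZMod n × ZMod n) ⋊[σ] Multiplicative (ZMod n) :=
    SemidirectProduct.inl (ofAdd (1, 0))
  let z : Multiplicative (ZMod n × ZMod n) ⋊[σ] Multiplicative (ZMod n) :=
    SemidirectProduct.inl (ofAdd (0, 1))
  have hxyx : x * y * x⁻¹ = SemidirectProduct.inl (ofAdd ((1 : ZMod n), (1 : ZMod n))) := by
    rw [← map_inv, ← SemidirectProduct.inl_aut, hσ]
    simp
  have hz : x * y * x⁻¹ * y⁻¹ = z := by
    rw [hxyx, ← map_inv, ← map_mul, ← ofAdd_neg, ← ofAdd_add, Prod.neg_mk, Prod.mk_add_mk]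
    simp [z]
  have hzord : orderOf z = n := by
    rw [orderOf_injective SemidirectProduct.inl SemidirectProduct.inl_injective,
      orderOf_ofAdd_eq_addOrderOf, Prod.addOrderOf, ZMod.addOrderOf_one, addOrderOf_zero,
      Nat.lcm_one_left]
  let F : puncturedSurfaceGen (g' + 1) 1 →
      Multiplicative (ZMod n × ZMod n) ⋊[σ] Multiplicative (ZMod n) :=
    Sum.elim (fun ib => if ib.1 = 0 then (if ib.2 then y else x) else 1) fun _ => z⁻¹
  have hx0 : F (Sum.inl (0, false)) = x := by simp [F]
  have hy0 : F (Sum.inl (0, true)) = y := by simp [F]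
  have hrel : ∀ w ∈ ({relator (g' + 1) 1} : Set (FreeGroup (puncturedSurfaceGen (g' + 1) 1))),
      FreeGroup.lift F w = 1 := by
    intro w hw
    rw [Set.mem_singleton_iff] at hw
    rw [hw, lift_relator']
    have h1 : ((List.finRange (g' + 1)).map fun i =>
        F (Sum.inl (i, false)) * F (Sum.inl (i, true)) * (F (Sum.inl (i, false)))⁻¹ *
          (F (Sum.inl (i, true)))⁻¹).prod = z := by
      rw [List.finRange_succ, List.map_cons, List.prod_cons, List.map_map]
      have htail : (List.map ((fun i : Fin (g' + 1) =>
          F (Sum.inl (i, false)) * F (Sum.inl (i, true)) * (F (Sum.inl (i, false)))⁻¹ *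
            (F (Sum.inl (i, true)))⁻¹) ∘ Fin.succ) (List.finRange g')).prod = 1 :=
        List.prod_eq_one fun t ht => by
          obtain ⟨i, -, rfl⟩ := List.mem_map.mp ht
          simp [F, Fin.succ_ne_zero i]
      rw [htail, mul_one, hx0, hy0]
      exact hz
    have h2 : ((List.finRange 1).map fun j => F (Sum.inr j)).prod = z⁻¹ := by
      simp [F, List.finRange_succ]
    rw [h1, h2, mul_inv_cancel]
  refine ⟨σ, PresentedGroup.toGroup hrel, fun j => ?_⟩
  rw [c, PresentedGroup.toGroup.of]
  change orderOf z⁻¹ = n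
  rw [orderOf_inv, hzord]

/-! ### Assembly -/

/-- **Uniform cusp-order quotients of `Γ_{g,r}`.** For a hyperbolic type `(g, r)` and `n ≥ 1` there is
a normal subgroup `N ⊴ Γ_{g,r}` of index dividing `n ^ 3` with `N ∩ ⟨c_j⟩ = ⟨c_j ^ n⟩` for EVERY cusp
`j` — a finite quotient in which all the cusp inertia groups have the same image `ℤ/n`.
[cite: MochizukiSemiAnbd2006, Ex. 2.10 p.31] -/
theorem exists_normal_inf_cuspInertia_eq (h : IsHyperbolicType g r) {n : ℕ} (hn : 0 < n) :
    ∃ N : Subgroup (PuncturedSurfaceGroup g r), N.Normal ∧ N.index ∣ n ^ 3 ∧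
      ∀ j, N ⊓ cuspInertia j = Subgroup.zpowers (c j ^ n) := by
  haveI : NeZero n := ⟨hn.ne'⟩
  have hcardZ : Nat.card (Multiplicative (ZMod n)) = n := by
    rw [Nat.card_congr Multiplicative.toAdd, Nat.card_zmod]
  have hcardZ2 : Nat.card (Multiplicative (ZMod n × ZMod n)) = n ^ 2 := by
    rw [Nat.card_congr Multiplicative.toAdd, Nat.card_prod, Nat.card_zmod, sq]
  obtain ⟨k, hk | hk⟩ := Nat.even_or_odd' r
  · obtain ⟨f, hf⟩ := exists_hom_of_even (g := g) hk n
    refine ⟨f.ker, inferInstance, ?_, fun j => ker_inf_cuspInertia_eq f j (hf j)⟩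
    exact (index_ker_dvd_card f).trans (by rw [hcardZ]; exact dvd_pow_self n three_ne_zero)
  · rcases Nat.eq_zero_or_pos k with rfl | hk0
    · -- `r = 1`, hence `g ≥ 1`
      subst hk
      have hg : 0 < g := by unfold IsHyperbolicType at h; omega
      obtain ⟨σ, f, hf⟩ := exists_hom_of_one hg n
      haveI : Finite (Multiplicative (ZMod n × ZMod n) ⋊[σ] Multiplicative (ZMod n)) :=
        Finite.of_equiv _ SemidirectProduct.equivProd.symm
      refine ⟨f.ker, inferInstance, ?_, fun j => ker_inf_cuspInertia_eq f j (hf j)⟩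
      refine (index_ker_dvd_card f).trans (dvd_of_eq ?_)
      rw [Nat.card_congr SemidirectProduct.equivProd, Nat.card_prod, hcardZ2, hcardZ]
      ring
    · obtain ⟨k', rfl⟩ : ∃ k', k = k' + 1 := ⟨k - 1, by omega⟩
      obtain ⟨f, hf⟩ := exists_hom_of_odd (g := g) (show r = 2 * k' + 3 by omega) n
      refine ⟨f.ker, inferInstance, ?_, fun j => ker_inf_cuspInertia_eq f j (hf j)⟩
      exact (index_ker_dvd_card f).trans (by rw [hcardZ2]; exact pow_dvd_pow n (by omega))

/-- **Refinement inside a given normal subgroup.** If `N₀ ⊴ Γ_{g,r}` contains all the `c_j ^ n`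
(e.g. `n` is a multiple of the orders of the cusp generators modulo `N₀`), then some normal
`N ⊆ N₀` of index dividing `[Γ : N₀] · n ^ 3` satisfies `N ∩ ⟨c_j⟩ = ⟨c_j ^ n⟩` for every `j`.
[cite: MochizukiSemiAnbd2006, Ex. 2.10 p.31] -/
theorem exists_normal_le_inf_cuspInertia_eq (h : IsHyperbolicType g r) {n : ℕ} (hn : 0 < n)
    (N₀ : Subgroup (PuncturedSurfaceGroup g r)) [N₀.Normal] (hc : ∀ j, c j ^ n ∈ N₀) :
    ∃ N : Subgroup (PuncturedSurfaceGroup g r), N ≤ N₀ ∧ N.Normal ∧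
      N.index ∣ N₀.index * n ^ 3 ∧ ∀ j, N ⊓ cuspInertia j = Subgroup.zpowers (c j ^ n) := by
  obtain ⟨N, hN, hidx, hcusp⟩ := exists_normal_inf_cuspInertia_eq (g := g) h hn
  haveI := hN
  refine ⟨N₀ ⊓ N, inf_le_left, inferInstance, ?_, fun j => ?_⟩
  · -- `Γ/(N₀ ∩ N)` embeds in `Γ/N₀ × Γ/N`
    have hker : ((QuotientGroup.mk' N₀).prod (QuotientGroup.mk' N)).ker = N₀ ⊓ N := by
      rw [MonoidHom.ker_prod, QuotientGroup.ker_mk', QuotientGroup.ker_mk']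
    rw [← hker, Subgroup.index_ker]
    refine (Subgroup.card_subgroup_dvd_card _).trans ?_
    rw [Nat.card_prod]
    exact mul_dvd_mul (dvd_of_eq (Subgroup.index_eq_card N₀).symm)
      ((dvd_of_eq (Subgroup.index_eq_card N).symm).trans hidx)
  · rw [inf_assoc, hcusp j]
    exact inf_eq_right.2 ((Subgroup.zpowers_le).2 (hc j))

end Literature.GroupTheory.CombinatorialGroupTheory.PuncturedSurfaceGroup
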